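import Mathlib
import Summits.ValiantsHypothesis.ValiantsHypothesis.Theorems.NNDivisionHard.Negative.BlindCubeIdentity
import Summits.ValiantsHypothesis.ValiantsHypothesis.Theorems.FifoMatchingNNDivisionHardLowDimFace
import Literature.Barriers.PneNP.TSPExtensionComplexityFaces
import Literature.Barriers.PneNP.ExtendedFormulationLinearImage

/-!
# The realizable clique-row law is false (crux `FifoMatching.NNDivisionHard`, stmt-ValiantsHypothesis-21181; Negative lane, part 2/2)

val-idea-39 g3 (b139 W5-P1), workfile `Cruxes/NNDivisionHard/CliqueRowBlind.lean` rev 6 §1/§5/§6; critic of record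
val-idea-crit-9 g1 (VERDICT #13 «retype P1 as the REALIZABLE clique-row law», VERDICT #29 price P-P1b).  The law P1: for every
budgeted Minkowski passenger `Q = conv{q_j}` the AUGMENTED CLIQUE-ROW SLACK of `COR(n) + Q`,
`M(a;(b,j)) = (1 + m_a) − ⟨udRow a, udPt b + q_j⟩`, has no cheap nonnegative factorization.  It is FALSE for every `n ≥ 1`:
the blind affine cube `Q♮ = conv{q_P}`, `q_P = 𝟙_{Pᶜ}𝟙_{Pᶜ}ᵀ − 𝟙_P𝟙_Pᵀ + diag(4·𝟙_P − 2 − |P|)` (an affine image of `[0,1]ⁿ`,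
`xc ≤ 2n`: `hasEFOfSize_unitCube`, `convexHull_range_udInd`, `hasEFOfSize_smul_qNat`) has `⟨udRow a, q_P⟩ = −|a||aΔP|`, so
`m ≡ 0` and the slack of `COR(n) + n•Q♮` is `(1 − |a∩b|)² + n|a||aΔP|`, which factors nonnegatively through `2n² + 3n + 2`
slots (part 1, `blind_rankPlus_le`), fewer than the law's `T 2 n = 2^{(log₂ n + 2)²} ≥ 2n² + 3n + 1`.
The FMPTW data `udInd / udPt / udMat / udRow` are the landed port's (`Theorems/FifoMatchingNNDivisionHardLowDimDefs`,
verbatim the line file's `XcDivision.ud*`); the negated law is stated INLINE in `cliqueRowsLaw_false` = `CliqueRowBlind.cliqueRows.Law` unfolded, with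
`T c n = 2 ^ ((Nat.log 2 n + c) ^ c)` written out.  Theorems and concrete data only; VP ≠ VNP is NOT proved; the crux stays OPEN.
-/

namespace Summit.ValiantsHypothesis.Theorems.NNDivisionHardNegative.CliqueRowBlind

open Matrix Finset
open Literature.Barriers.PneNP (HasEFOfSize)
open Literature.Combinatorics.Optimization.FixedSizePsdRank (flat vecOuter)
open Summit.ValiantsHypothesis.ValiantsHypothesis.Theorems.FifoMatching.XcDivision
  (udInd udPt udRow udInd_apply ud_data udRow_dotProduct_flat_diagonal)
open Summit.ValiantsHypothesis.Theorems.NNDivisionHardNegative.BlindCubeIdentity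
open scoped Pointwise

/-! ## §1 The blind affine cube `Q♮` -/

/-- the vertex `q_P` of the blind affine cube, flattened: `q_P = 𝟙_{Pᶜ}𝟙_{Pᶜ}ᵀ − 𝟙_P𝟙_Pᵀ + diag(4·𝟙_P − 2 − |P|)`,
i.e. `(q_P)_ii = 2P_i − 1 − |P|`, `(q_P)_im = 1 − P_i − P_m` (`i ≠ m`) — entries AFFINE in `𝟙_P`. -/
def qNat {n : ℕ} (P : Finset (Fin n)) : Fin (n * n) → ℝ :=
  udPt Pᶜ - udPt P + flat (Matrix.diagonal fun i => 4 * udInd P i - 2 - (P.card : ℝ))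

/-- helper (sum_udInd_mem): see the module docstring. -/
theorem sum_udInd_mem {n : ℕ} (a P : Finset (Fin n)) : ∑ i ∈ a, udInd P i = ((a ∩ P).card : ℝ) := by
  classical
  simp only [udInd_apply]
  rw [Finset.sum_ite_mem, Finset.sum_const, nsmul_eq_mul, mul_one]

/-- ★ `⟨udRow a, q_P⟩ = −|a|·|a Δ P|` (with `|a Δ P| = |a| + |P| − 2|a ∩ P|`). -/
theorem udRow_dotProduct_qNat {n : ℕ} (a P : Finset (Fin n)) :
    udRow a ⬝ᵥ qNat P = -((a.card : ℝ) * (a.card + P.card - 2 * (a ∩ P).card)) := by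
  classical
  obtain ⟨-, -, slack, -⟩ := ud_data n
  have h1 : udRow a ⬝ᵥ udPt Pᶜ = 1 - (1 - ((a ∩ Pᶜ).card : ℝ)) ^ 2 := by linarith [slack a Pᶜ]
  have h2 : udRow a ⬝ᵥ udPt P = 1 - (1 - ((a ∩ P).card : ℝ)) ^ 2 := by linarith [slack a P]
  have h3 : udRow a ⬝ᵥ flat (Matrix.diagonal fun i => 4 * udInd P i - 2 - (P.card : ℝ)) =
      4 * (a ∩ P).card - (2 + P.card) * a.card := by
    rw [udRow_dotProduct_flat_diagonal, Finset.sum_sub_distrib, Finset.sum_sub_distrib, ← Finset.mul_sum,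
      sum_udInd_mem, Finset.sum_const, Finset.sum_const, nsmul_eq_mul, nsmul_eq_mul]
    ring
  have hc : ((a ∩ Pᶜ).card : ℝ) = a.card - (a ∩ P).card := by
    have : (a ∩ Pᶜ).card + (a ∩ P).card = a.card := by
      rw [← Finset.card_union_of_disjoint]
      · congr 1; ext i; simp only [Finset.mem_union, Finset.mem_inter, Finset.mem_compl]; tauto
      · exact Finset.disjoint_left.2 fun i hi hi' =>
          (Finset.mem_compl.1 (Finset.mem_inter.1 hi).2) (Finset.mem_inter.1 hi').2
    have := congrArg (fun k : ℕ => (k : ℝ)) this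
    push_cast at this; linarith
  rw [qNat, dotProduct_add, dotProduct_sub, h1, h2, h3, hc]
  ring

/-- `q_a` attains `0`, every other `q_P` is `≤ 0` on the row `udRow a`: `m_a = 0`, maximiser pattern `{P = a} ∪ {a = ∅}`. -/
theorem udRow_dotProduct_qNat_self {n : ℕ} (a : Finset (Fin n)) : udRow a ⬝ᵥ qNat a = 0 := by
  rw [udRow_dotProduct_qNat, Finset.inter_self]; ring

/-- helper (udRow_dotProduct_qNat_nonpos): see the module docstring. -/
theorem udRow_dotProduct_qNat_nonpos {n : ℕ} (a P : Finset (Fin n)) : udRow a ⬝ᵥ qNat P ≤ 0 := by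
  rw [udRow_dotProduct_qNat, neg_nonpos]
  have h1 : ((a ∩ P).card : ℝ) ≤ a.card := by exact_mod_cast Finset.card_le_card Finset.inter_subset_left
  have h2 : ((a ∩ P).card : ℝ) ≤ P.card := by exact_mod_cast Finset.card_le_card Finset.inter_subset_right
  exact mul_nonneg (Nat.cast_nonneg _) (by linarith)

/-- ★ **the augmented clique-row slack of `COR(n) + λ•Q♮`** (row value `1 + m_a = 1`):
`1 − ⟨udRow a, udPt b + λ q_P⟩ = (1 − |a∩b|)² + λ·|a|·|aΔP|`. -/
theorem blindPair_slack {n : ℕ} (lam : ℝ) (a b P : Finset (Fin n)) :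
    1 - udRow a ⬝ᵥ (udPt b + lam • qNat P) =
      (1 - ((a ∩ b).card : ℝ)) ^ 2 + lam * (a.card * (a.card + P.card - 2 * (a ∩ P).card)) := by
  obtain ⟨-, -, slack, -⟩ := ud_data n
  rw [dotProduct_add, dotProduct_smul, smul_eq_mul, udRow_dotProduct_qNat, ← sub_sub, slack]
  ring

/-- validity: `udRow a ≤ 1` on every `udPt b + λ q_P` (`λ ≥ 0`). -/
theorem blindPair_valid {n : ℕ} {lam : ℝ} (hlam : 0 ≤ lam) (a b P : Finset (Fin n)) :
    udRow a ⬝ᵥ (udPt b + lam • qNat P) ≤ 1 := by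
  have := blindPair_slack lam a b P
  have hD : 0 ≤ (a.card : ℝ) * (a.card + P.card - 2 * (a ∩ P).card) := by
    have := udRow_dotProduct_qNat_nonpos a P
    rw [udRow_dotProduct_qNat, neg_nonpos] at this; exact this
  nlinarith [sq_nonneg (1 - ((a ∩ b).card : ℝ)), mul_nonneg hlam hD]



/-- ★ the factorization of the slack of `COR(n) + n•Q♮` through `BIdx n` (`2n² + 3n + 2` slots), `n ≥ 1` — part 1's
`blind_rankPlus_le` at `λ = n`, transported along `blindPair_slack`. -/
theorem blindPair_factorization_self (n : ℕ) (hn : 1 ≤ n) :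
    ∃ (U : Finset (Fin n) → BIdx n → ℝ) (V : Finset (Fin n) × Finset (Fin n) → BIdx n → ℝ),
      (∀ a idx, 0 ≤ U a idx) ∧ (∀ c idx, 0 ≤ V c idx) ∧
      ∀ a b P : Finset (Fin n),
        1 - udRow a ⬝ᵥ (udPt b + (n : ℝ) • qNat P) = ∑ idx, U a idx * V (b, P) idx := by
  obtain ⟨U, V, hU, hV, h⟩ := blind_rankPlus_le n n (by exact_mod_cast hn) (by linarith)
  refine ⟨U, V, hU, hV, fun a b P => ?_⟩
  rw [blindPair_slack, ← h a b P]
  push_cast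
  ring

section CubeEF
open Literature.Barriers.PneNP (hasEFOfSize_of_system)

/-- the unit cube `[0,1]ⁿ` as a set of functions. -/
def unitCube (n : ℕ) : Set (Fin n → ℝ) := Set.univ.pi fun _ => Set.Icc (0 : ℝ) 1

/-- ★ `xc([0,1]ⁿ) ≤ 2n`: the slack system `x_i − y_{inl i} = 0`, `x_i + y_{inr i} = 1`, `y ≥ 0`. -/
theorem hasEFOfSize_unitCube (n : ℕ) : HasEFOfSize (unitCube n) (n + n) := by
  classical
  let E : Matrix (Fin n ⊕ Fin n) (Fin n) ℝ := Matrix.of fun r i => if i = Sum.elim id id r then 1 else 0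
  let F : Matrix (Fin n ⊕ Fin n) (Fin n ⊕ Fin n) ℝ :=
    Matrix.of fun r s => if s = r then Sum.elim (fun _ => (-1 : ℝ)) (fun _ => 1) r else 0
  let g : Fin n ⊕ Fin n → ℝ := Sum.elim (fun _ => 0) (fun _ => 1)
  have hE : ∀ (x : Fin n → ℝ) r, (E *ᵥ x) r = x (Sum.elim id id r) := by
    intro x r
    simp only [Matrix.mulVec, dotProduct, E, Matrix.of_apply]
    rw [Finset.sum_eq_single (Sum.elim id id r)]
    · simp
    · intro i _ hi; simp [hi]
    · intro h; exact absurd (Finset.mem_univ _) h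
  have hF : ∀ (y : Fin n ⊕ Fin n → ℝ) r, (F *ᵥ y) r = Sum.elim (fun _ => (-1 : ℝ)) (fun _ => 1) r * y r := by
    intro y r
    simp only [Matrix.mulVec, dotProduct, F, Matrix.of_apply]
    rw [Finset.sum_eq_single r]
    · simp
    · intro s _ hs; simp [hs]
    · intro h; exact absurd (Finset.mem_univ _) h
  have hsys : unitCube n = {x | ∃ y : Fin n ⊕ Fin n → ℝ, (∀ j, 0 ≤ y j) ∧ E *ᵥ x + F *ᵥ y = g} := by
    ext x
    simp only [unitCube, Set.mem_univ_pi, Set.mem_Icc, Set.mem_setOf_eq]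
    constructor
    · intro hx
      refine ⟨Sum.elim (fun i => x i) (fun i => 1 - x i), ?_, ?_⟩
      · rintro (i | i)
        · simpa using (hx i).1
        · simpa using (hx i).2
      · funext r
        rw [Pi.add_apply, hE, hF]
        rcases r with i | i <;> simp [g]
    · rintro ⟨y, hy, hsys⟩ i
      have h1 := congrFun hsys (Sum.inl i)
      have h2 := congrFun hsys (Sum.inr i)
      rw [Pi.add_apply, hE, hF] at h1 h2
      simp only [Sum.elim_inl, Sum.elim_inr, id, g] at h1 h2
      constructor
      · linarith [hy (Sum.inl i)]
      · linarith [hy (Sum.inr i)]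
  rw [hsys]
  have h := hasEFOfSize_of_system (ι := Fin n) E F g
  simpa [Fintype.card_sum, Fintype.card_fin] using h

/-- `conv{𝟙_P : P ⊆ [n]} = [0,1]ⁿ`. -/
theorem convexHull_range_udInd (n : ℕ) :
    convexHull ℝ (Set.range (udInd : Finset (Fin n) → Fin n → ℝ)) = unitCube n := by
  classical
  have hr : Set.range (udInd : Finset (Fin n) → Fin n → ℝ) = Set.univ.pi fun _ => ({0, 1} : Set ℝ) := by
    ext x
    simp only [Set.mem_range, Set.mem_univ_pi, Set.mem_insert_iff, Set.mem_singleton_iff]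
    constructor
    · rintro ⟨P, rfl⟩ i
      rw [udInd_apply]; split_ifs <;> simp
    · intro hx
      refine ⟨Finset.univ.filter fun i => x i = 1, funext fun i => ?_⟩
      rw [udInd_apply]
      rcases hx i with h | h
      · rw [if_neg (by simp [h]), h]
      · rw [if_pos (by simp [h]), h]
  rw [hr, convexHull_pi, unitCube]
  congr 1; funext i
  rw [convexHull_pair, segment_eq_Icc (zero_le_one' ℝ)]

/-- the linear part of `P ↦ n•q_P`. -/
def qLin (n : ℕ) : (Fin n → ℝ) →ₗ[ℝ] (Fin (n * n) → ℝ) where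
  toFun y p :=
    (n : ℝ) * (if (finProdFinEquiv.symm p).1 = (finProdFinEquiv.symm p).2
      then 2 * y (finProdFinEquiv.symm p).1 - ∑ j, y j
      else -(y (finProdFinEquiv.symm p).1) - y (finProdFinEquiv.symm p).2)
  map_add' y z := by
    funext p
    simp only [Pi.add_apply, Finset.sum_add_distrib]
    split_ifs <;> ring
  map_smul' c y := by
    funext p
    simp only [Pi.smul_apply, smul_eq_mul, RingHom.id_apply, ← Finset.mul_sum]
    split_ifs <;> ring

/-- the constant part of `P ↦ n•q_P`. -/
def qConst (n : ℕ) : Fin (n * n) → ℝ := fun p =>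
  if (finProdFinEquiv.symm p).1 = (finProdFinEquiv.symm p).2 then -(n : ℝ) else (n : ℝ)

/-- helper (sum_udInd_univ): see the module docstring. -/
theorem sum_udInd_univ {n : ℕ} (P : Finset (Fin n)) : ∑ j, udInd P j = (P.card : ℝ) := by
  classical
  simp only [udInd_apply]
  rw [Finset.sum_boole, Finset.filter_mem_eq_inter, Finset.univ_inter]

/-- `n•q_P = L(𝟙_P) + v` entrywise. -/
theorem smul_qNat_eq_affine {n : ℕ} (P : Finset (Fin n)) :
    (n : ℝ) • qNat P = qLin n (udInd P) + qConst n := by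
  classical
  funext p
  simp only [qNat, udPt, Pi.smul_apply, Pi.add_apply, Pi.sub_apply, smul_eq_mul, qLin, qConst, LinearMap.coe_mk,
    AddHom.coe_mk, Literature.Combinatorics.Optimization.FixedSizePsdRank.vecOuter,
    flat, Matrix.diagonal_apply, sum_udInd_univ]
  have hc : ∀ i, udInd Pᶜ i = 1 - udInd P i := by
    intro i; rw [udInd_apply, udInd_apply]; by_cases h : i ∈ P <;> simp [h]
  rw [hc, hc]
  split_ifs with h
  · rw [h]; ring
  · ring


/-- `2n² + 3n + 1 ≤ T 2 n = 2^{(log₂ n + 2)²}`. -/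
theorem budget_le_T_two (n : ℕ) : 2 * n ^ 2 + 3 * n + 1 ≤ 2 ^ ((Nat.log 2 n + 2) ^ 2) := by
  have hlt : n < 2 ^ (Nat.log 2 n + 1) := Nat.lt_pow_succ_log_self (by norm_num) n
  set L := Nat.log 2 n with hL
  have h1 : 2 * n ^ 2 + 3 * n + 1 ≤ 2 * (n + 1) ^ 2 := by nlinarith
  have h2 : (n + 1) ^ 2 ≤ (2 ^ (L + 1)) ^ 2 := Nat.pow_le_pow_left (by omega) 2
  have h3 : 2 * (2 ^ (L + 1)) ^ 2 = 2 ^ (2 * L + 3) := by ring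
  have h4 : 2 ^ (2 * L + 3) ≤ 2 ^ ((L + 2) ^ 2) := Nat.pow_le_pow_right (by norm_num) (by nlinarith)
  omega

/-- ★ the budget of the blind cube: `xc(n•Q♮(n)) ≤ 2n² + 3n + 1`. -/
theorem hasEFOfSize_smul_qNat (n : ℕ) :
    HasEFOfSize (convexHull ℝ (Set.range fun P : Finset (Fin n) => (n : ℝ) • qNat P)) (2 * n ^ 2 + 3 * n + 1) := by
  have h1 := (hasEFOfSize_unitCube n).image_affine (qLin n) (qConst n)
  rw [← convexHull_range_udInd] at h1
  have himg : (fun x => qLin n x + qConst n) '' convexHull ℝ (Set.range (udInd : Finset (Fin n) → Fin n → ℝ)) =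
      convexHull ℝ (Set.range fun P : Finset (Fin n) => (n : ℝ) • qNat P) := by
    let f : (Fin n → ℝ) →ᵃ[ℝ] (Fin (n * n) → ℝ) := (qLin n).toAffineMap + AffineMap.const ℝ (Fin n → ℝ) (qConst n)
    have hf : (fun x => qLin n x + qConst n) = ⇑f := by funext x; simp [f]
    have hcomp : (⇑f ∘ udInd) = fun P : Finset (Fin n) => (n : ℝ) • qNat P := by
      funext P
      rw [Function.comp_apply, ← hf, smul_qNat_eq_affine]
    rw [hf, AffineMap.image_convexHull, ← Set.range_comp, hcomp]
  rw [himg] at h1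
  exact h1.of_le (by nlinarith)

end CubeEF

/-- ★★ **The realizable clique-row law is FALSE** — verbatim `CliqueRowBlind.cliqueRows.Law`, unfolded
(rows `udRow a ≤ 1`, the FMPTW clique inequalities of `COR(n)`; `T c n = 2^{(log₂ n + c)^c}` the line's budget scale). -/
theorem cliqueRowsLaw_false :
    ¬ (∀ c : ℕ, ∃ n₀ : ℕ, ∀ n ≥ n₀, ∀ (K : ℕ) (q : Fin (K + 1) → (Fin (n * n) → ℝ)) (r : ℕ),
        HasEFOfSize (convexHull ℝ (Set.range q)) r →
        ∀ m : Finset (Fin n) → ℝ, (∀ a j, udRow a ⬝ᵥ q j ≤ m a) → (∀ a, ∃ j, udRow a ⬝ᵥ q j = m a) →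
        ∀ (U : Finset (Fin n) → Option (Fin r) → ℝ) (V : Finset (Fin n) × Fin (K + 1) → Option (Fin r) → ℝ),
          (∀ a i, 0 ≤ U a i) → (∀ p i, 0 ≤ V p i) →
          (∀ a b j, ((1 : ℝ) + m a) - udRow a ⬝ᵥ (udPt b + q j) = ∑ i, U a i * V (b, j) i) →
          2 ^ ((Nat.log 2 n + c) ^ c) < r) := by
  classical
  intro hL
  obtain ⟨n₀, hn₀⟩ := hL 2
  obtain ⟨n, hnn₀, hn1⟩ : ∃ n, n₀ ≤ n ∧ 1 ≤ n := ⟨max n₀ 1, le_max_left _ _, le_max_right _ _⟩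
  have hK : Fintype.card (Finset (Fin n)) = (Fintype.card (Finset (Fin n)) - 1) + 1 :=
    (Nat.sub_add_cancel Fintype.card_pos).symm
  set K := Fintype.card (Finset (Fin n)) - 1 with hKdef
  let eC : Finset (Fin n) ≃ Fin (K + 1) := Fintype.equivFinOfCardEq hK
  let q : Fin (K + 1) → (Fin (n * n) → ℝ) := fun j => (n : ℝ) • qNat (eC.symm j)
  have hcard : Fintype.card (BIdx n) = Fintype.card (Option (Fin (2 * n ^ 2 + 3 * n + 1))) := by
    rw [card_BIdx, Fintype.card_option, Fintype.card_fin]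
  let eS : BIdx n ≃ Option (Fin (2 * n ^ 2 + 3 * n + 1)) := Fintype.equivOfCardEq hcard
  have hrange : Set.range q = Set.range (fun P : Finset (Fin n) => (n : ℝ) • qNat P) := by
    ext x; constructor
    · rintro ⟨j, rfl⟩; exact ⟨eC.symm j, rfl⟩
    · rintro ⟨P, rfl⟩; exact ⟨eC P, by simp [q]⟩
  have hQ : HasEFOfSize (convexHull ℝ (Set.range q)) (2 * n ^ 2 + 3 * n + 1) := by
    rw [hrange]; exact hasEFOfSize_smul_qNat n
  obtain ⟨U, V, hU, hV, hfac⟩ := blindPair_factorization_self n hn1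
  have key := hn₀ n hnn₀ K q (2 * n ^ 2 + 3 * n + 1) hQ (fun _ => 0)
    (fun a j => by
      show udRow a ⬝ᵥ ((n : ℝ) • qNat (eC.symm j)) ≤ 0
      rw [dotProduct_smul, smul_eq_mul]
      exact mul_nonpos_of_nonneg_of_nonpos (Nat.cast_nonneg n) (udRow_dotProduct_qNat_nonpos a _))
    (fun a => ⟨eC a, by
      show udRow a ⬝ᵥ ((n : ℝ) • qNat (eC.symm (eC a))) = 0
      rw [Equiv.symm_apply_apply, dotProduct_smul, smul_eq_mul, udRow_dotProduct_qNat_self, mul_zero]⟩)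
    (fun a i => U a (eS.symm i)) (fun p i => V (p.1, eC.symm p.2) (eS.symm i))
    (fun a i => hU a _) (fun p i => hV _ _)
    (fun a b j => by
      show ((1 : ℝ) + 0) - udRow a ⬝ᵥ (udPt b + (n : ℝ) • qNat (eC.symm j)) =
        ∑ i, U a (eS.symm i) * V (b, eC.symm j) (eS.symm i)
      rw [add_zero, hfac a b (eC.symm j)]
      exact (Equiv.sum_comp eS.symm (fun idx => U a idx * V (b, eC.symm j) idx)).symm)
  have hle := budget_le_T_two n
  omega

end Summit.ValiantsHypothesis.Theorems.NNDivisionHardNegative.CliqueRowBlind
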